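import Literature.InformationTheory.QuantumCodes.PlanarCodeSpaceTimePaths
import Literature.InformationTheory.QuantumCodes.PlanarCodeCrossingPathsBound
import Literature.InformationTheory.QuantumCodes.ToricCodePhenomenological
import HarnessLib

/-!
# The Dennis–Kitaev–Landahl–Preskill counting bound for the planar surface code with NOISY syndrome measurement:
# half-faulty crossing space-time paths, their number `≤ (k+2)·T·cₙ(ℤ³)`, and
# `Prob[odd-crossing residual] ≤ (k+2)·T·C·r^{k+2}/(1-r)` under `cₙ(ℤ³) ≤ C νⁿ`, `r = 2ν√(p(1-p))` (`q = p`)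

Topic `Literature/InformationTheory/QuantumCodes` (venture QEC, LADDER-QEC rung Q5, PARTITION row 09 "phenomenological";
qec-type-09 gen 6, cell item 09.PSAW (C)). All PROVED, kernel axioms, no named fact. Space-time twin of
`PlanarCodeCrossingPathsBound.lean`, on top of `PlanarCodeSpaceTimePaths.lean` (`IsSTCrossing`, `pathLocs`,
`st_exists_crossing_subset`) and lit-2's generic `T`-round model `CSSPhenomenologicalThreshold.lean` for `H = planarHX k`
(histories, `stMatrix`, `stSyn`, projection `proj`, `phenomenologicalWeight`):

* ★ `st_exists_crossing_of_oddResidual` — if the residual `D(∂E) + E` of a MINIMUM-WEIGHT space-time decoder `D`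
  projects to a chain crossing the bottom rough boundary an odd number of times (as the residual of every failed memory
  experiment does — one encoded qubit; that identification is Summits-side), some rough-to-rough self-avoiding space-time
  path with `n ≥ k + 2` bonds has at least `n/2` of its fault locations in `supp E` (DKLP eq. (e_ineq) on the space-time
  lattice, via the generic `card_le_two_mul_card_inter_supp`);
* ★ `st_sum_oddResidual_le` — with equal qubit and measurement error rates `q = p ≤ 1/2` and the walk-count hypothesis
  `ToricCode.SAWCountBound3 C ν` (`cₙ(ℤ³) ≤ C νⁿ`), for `r = 2ν√(p(1-p)) < 1`:
  `Σ_{E : odd-crossing residual} w(E) ≤ Σ_{n ≥ k+2} (k+2)·T·cₙ·(4p̃)^{n/2} ≤ (k+2)·T·C·r^{k+2}/(1-r)`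
  (`(k+2)·T` bottom rough space-time sites to start from — the relative analogue of DKLP's prefactor `L²T`);
* `st_tendsto_sum_oddResidual` — hence for `4ν² p(1-p) < 1` and polynomially many rounds `T(k)` these sums tend to `0`.

The threshold statements (`p₀(ν)`, the certified instance `μ(ℤ³) ≤ 4.7476 ⇒ p_c > .0112`) are Summits-side.

## References

* [DennisEtAl2002] E. Dennis, A. Kitaev, A. Landahl, J. Preskill, *Topological quantum memory*, J. Math. Phys. 43 (2002)
  4452–4505, arXiv:quant-ph/0110143, §5.2 (eqs. (e_ineq), (saw_prob), (saw_L)), §5.3 (eqs. (saw_3), (threshold_iso),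
  (fail_iso); planar codes: relative polygons, "This change has no effect on the estimate of the threshold").
* [MadrasSlade1993] N. Madras, G. Slade, *The Self-Avoiding Walk*, Birkhäuser 1993, §1.1 (`cₙ`).
-/

namespace Literature.InformationTheory.QuantumCodes

namespace PlanarCode

open Finset Matrix Filter Topology CSSPhenom
open Literature.Probability.LatticeModels (Site)
open Literature.Probability.RandomPlanarGeometry
open Literature.Probability.RandomPlanarGeometry.SAW.Zd (saws card_saws)

variable {k T : ℕ}

/-! ### The half-weight step on the space-time lattice -/

/-- `x + y = 0 → x = y` in `ℤ₂`. [folklore] -/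
private theorem zmod2_eq_of_add_eq_zero' {x y : ZMod 2} (h : x + y = 0) : x = y := by
  revert x y; decide

/-- ★ **An odd-crossing residual of a minimum-weight SPACE-TIME decoder contains a long, half-faulty rough-to-rough
self-avoiding space-time path.** Let `D` be a minimum-weight decoder of the `T`-round memory experiment of the
`H_X`-sector of the `k`-th planar code (syndrome `∂ = stSyn`, undetectable histories `stCycles`, Hamming weight) and `E`
a history whose residual `C = D(∂E) + E` projects to a chain crossing the bottom rough boundary an odd number of times.
Then some rough-to-rough self-avoiding space-time path `(b₀, t₀, ω)` with `n ≥ k + 2` bonds has at least `n/2` of its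
fault locations in `supp E`. [cite: DennisEtAl2002, §5.2 (eq. (e_ineq) on the space-time lattice; H ≥ L)] -/
theorem st_exists_crossing_of_oddResidual {D : STDecoder (PlanarCheck k) (PlanarQubit k) T}
    (hD : D.IsMinWeight (stSyn (planarHX k) T) (stCycles (planarHX k) T) hammingNorm)
    {E : History (PlanarCheck k) (PlanarQubit k) T}
    (hodd : ∑ b : Fin (k + 2), proj (D (stSyn (planarHX k) T E) + E) (Sum.inl (0, b)) = 1) :
    ∃ (b₀ : Fin (k + 2)) (t₀ : Fin T) (n : ℕ) (ω : ℕ → Site 3), ω ∈ saws 3 n ∧ IsSTCrossing k T b₀ t₀ n ω ∧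
      k + 2 ≤ n ∧ n ≤ 2 * (pathLocs b₀ t₀ n ω ∩ supp E).card := by
  classical
  set E' := D (stSyn (planarHX k) T E) with hE'
  have hc : stMatrix (planarHX k) T *ᵥ (E' + E) = 0 := hD.add_mem E
  obtain ⟨b₀, t₀, n, ω, hω, hX, hsub⟩ :=
    st_exists_crossing_subset (Er := supp (E' + E)) hc (fun ℓ hℓ => by simpa [supp] using hℓ) hodd
  refine ⟨b₀, t₀, n, ω, hω, hX, le_length_of_isSTCrossing hω hX, ?_⟩
  set χ : History (PlanarCheck k) (PlanarQubit k) T := fun ℓ => if ℓ ∈ pathLocs b₀ t₀ n ω then 1 else 0 with hχ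
  have hχ0 : stMatrix (planarHX k) T *ᵥ χ = 0 := stMatrix_mulVec_pathLocs hω hX (χ := χ) fun ℓ => rfl
  have hsyn : stSyn (planarHX k) T (E' + χ) = stSyn (planarHX k) T E := by
    show stMatrix (planarHX k) T *ᵥ (E' + χ) = stMatrix (planarHX k) T *ᵥ E
    rw [Matrix.mulVec_add, hχ0, add_zero]
    rw [Matrix.mulVec_add] at hc
    funext x
    exact zmod2_eq_of_add_eq_zero' (congrFun hc x)
  have hmin : hammingNorm E' ≤ hammingNorm (E' + χ) := by
    have := hD.weight_le (E' + χ)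
    rwa [hsyn] at this
  calc n = (pathLocs b₀ t₀ n ω).card := (card_pathLocs hω hX).symm
    _ ≤ 2 * (pathLocs b₀ t₀ n ω ∩ supp E).card := card_le_two_mul_card_inter_supp (fun ℓ => rfl) hsub hmin

/-! ### Counting and the union bound -/

/-- A history is determined by its support. [folklore] -/
private theorem supp_injective' {V : Type*} [Fintype V] [DecidableEq V] :
    Function.Injective (supp : (V → ZMod 2) → Finset V) := by
  intro e₁ e₂ h
  funext v
  have h1 : v ∈ supp e₁ ↔ v ∈ supp e₂ := by rw [h]
  simp only [supp, Finset.mem_filter, Finset.mem_univ, true_and] at h1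
  have key : ∀ x y : ZMod 2, (x ≠ 0 ↔ y ≠ 0) → x = y := by decide
  exact key _ _ h1

/-- The walk-count constant is at least `1` (`c₀ = 1`), in particular non-negative. [cite: DennisEtAl2002, §5.3 eq. (saw_3)] -/
private theorem nonneg_of_sawCountBound3 {C ν : ℝ} (h : ToricCode.SAWCountBound3 C ν) : 0 ≤ C := by
  have h0 := h 0
  rw [SAW.Zd.count_zero, pow_zero, mul_one, Nat.cast_one] at h0
  linarith

open Classical in
/-- ★ **DKLP's counting bound for the planar surface code with noisy measurement** (relative form of eq. (fail_iso), `q = p`,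
the tree's constants): for a minimum-weight space-time decoder `D` of the `T`-round memory experiment of the `H_X`-sector of
the `k`-th planar code, equal qubit / measurement error rates `0 ≤ p ≤ 1/2`, and a walk-count bound `cₙ(ℤ³) ≤ C νⁿ` with
`r = 2ν√(p(1-p)) < 1`, the total probability of the histories whose residual projects to an odd bottom crossing is at most
`Σ_{n=k+2}^{#locations} (k+2)·T·cₙ·(2√(p(1-p)))ⁿ ≤ (k+2)·T·C·r^{k+2}/(1-r)`.
[cite: DennisEtAl2002, §5.2 eqs. (saw_prob), (saw_L), §5.3 eqs. (saw_3), (fail_iso)] -/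
theorem st_sum_oddResidual_le {C ν : ℝ} (hν : 0 < ν) (hC : ToricCode.SAWCountBound3 C ν)
    {D : STDecoder (PlanarCheck k) (PlanarQubit k) T}
    (hD : D.IsMinWeight (stSyn (planarHX k) T) (stCycles (planarHX k) T) hammingNorm)
    {p : ℝ} (hp0 : 0 ≤ p) (hp : p ≤ 1 / 2) (hr1 : 2 * ν * Real.sqrt (p * (1 - p)) < 1) :
    ∑ E ∈ univ.filter (fun E : History (PlanarCheck k) (PlanarQubit k) T =>
        ∑ b : Fin (k + 2), proj (D (stSyn (planarHX k) T E) + E) (Sum.inl (0, b)) = 1),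
        phenomenologicalWeight T p p (supp E) ≤
      ((k : ℝ) + 2) * T * C * (2 * ν * Real.sqrt (p * (1 - p))) ^ (k + 2) / (1 - 2 * ν * Real.sqrt (p * (1 - p))) := by
  classical
  set s := Real.sqrt (p * (1 - p)) with hs
  set r := 2 * ν * s with hr
  have hs0 : 0 ≤ s := Real.sqrt_nonneg _
  have hr0 : 0 ≤ r := by rw [hr]; positivity
  have h1r : 0 < 1 - r := by linarith
  have hC0 : 0 ≤ C := nonneg_of_sawCountBound3 hC
  simp only [ToricCode.phenomenologicalWeight_self]
  -- Step 1: the odd-residual histories, reindexed by their supports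
  set F := univ.filter (fun E : History (PlanarCheck k) (PlanarQubit k) T =>
    ∑ b : Fin (k + 2), proj (D (stSyn (planarHX k) T E) + E) (Sum.inl (0, b)) = 1) with hF
  have hsum : ∑ E ∈ F, bernoulliWeight p (supp E) = ∑ S ∈ F.image supp, bernoulliWeight p S :=
    (Finset.sum_image fun e₁ _ e₂ _ h => supp_injective' h).symm
  rw [hsum]
  -- Step 2: the covering family — rough-to-rough self-avoiding space-time paths graded by their number of bonds
  set M := Fintype.card (HistoryLoc (PlanarQubit k) (PlanarCheck k) T) with hM
  set I : Finset (Σ _ : ℕ, (Fin (k + 2) × Fin T) × (ℕ → Site 3)) :=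
    (Finset.Ico (k + 2) (M + 1)).sigma fun n => (univ : Finset (Fin (k + 2) × Fin T)) ×ˢ saws 3 n with hI
  set Ps : Finset (Σ _ : ℕ, (Fin (k + 2) × Fin T) × (ℕ → Site 3)) :=
    I.filter (fun x => IsSTCrossing k T x.2.1.1 x.2.1.2 x.1 x.2.2) with hPs
  set Tm : (Σ _ : ℕ, (Fin (k + 2) × Fin T) × (ℕ → Site 3)) → Finset (HistoryLoc (PlanarQubit k) (PlanarCheck k) T) :=
    fun x => pathLocs x.2.1.1 x.2.1.2 x.1 x.2.2 with hTm
  have hmem : ∀ x ∈ Ps, x.2.2 ∈ saws 3 x.1 ∧ IsSTCrossing k T x.2.1.1 x.2.1.2 x.1 x.2.2 := by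
    intro x hx
    rw [hPs, Finset.mem_filter, hI, Finset.mem_sigma, Finset.mem_product] at hx
    exact ⟨hx.1.2.2, hx.2⟩
  have hcard : ∀ x ∈ Ps, (Tm x).card = x.1 := fun x hx => card_pathLocs (hmem x hx).1 (hmem x hx).2
  have hcover : ∀ S ∈ F.image supp, ∃ x ∈ Ps, (Tm x).card ≤ 2 * (Tm x ∩ S).card := by
    intro S hS
    obtain ⟨E, hE, rfl⟩ := Finset.mem_image.1 hS
    have hodd := (Finset.mem_filter.1 hE).2
    obtain ⟨b₀, t₀, n, ω, hω, hX, hkn, hhalf⟩ := st_exists_crossing_of_oddResidual hD hodd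
    have hnM : n ≤ M := by
      rw [← card_pathLocs hω hX]
      exact Finset.card_le_univ _
    refine ⟨⟨n, (b₀, t₀), ω⟩, ?_, ?_⟩
    · rw [hPs, Finset.mem_filter, hI, Finset.mem_sigma, Finset.mem_product, Finset.mem_Ico]
      exact ⟨⟨⟨hkn, Nat.lt_succ_of_le hnM⟩, Finset.mem_univ _, hω⟩, hX⟩
    · show (pathLocs b₀ t₀ n ω).card ≤ 2 * (pathLocs b₀ t₀ n ω ∩ supp E).card
      rw [card_pathLocs hω hX]
      exact hhalf
  have h1 := sum_bernoulliWeight_le_of_cover hp0 hp Ps Tm (F.image supp) hcover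
  -- Step 3: `Σ_{paths} (2s)^n ≤ Σ_{n} (k+2)·T·cₙ·(2s)^n`
  have h2 : ∑ x ∈ Ps, (2 * s) ^ (Tm x).card ≤ ∑ x ∈ I, (2 * s) ^ x.1 :=
    calc ∑ x ∈ Ps, (2 * s) ^ (Tm x).card = ∑ x ∈ Ps, (2 * s) ^ x.1 :=
          Finset.sum_congr rfl fun x hx => by rw [hcard x hx]
      _ ≤ ∑ x ∈ I, (2 * s) ^ x.1 :=
          Finset.sum_le_sum_of_subset_of_nonneg (Finset.filter_subset _ _) fun _ _ _ => pow_nonneg (by positivity) _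
  have h3 : ∑ x ∈ I, (2 * s) ^ x.1 =
      ∑ n ∈ Finset.Ico (k + 2) (M + 1), ((k : ℝ) + 2) * T * ((saws 3 n).card : ℝ) * (2 * s) ^ n := by
    rw [hI, Finset.sum_sigma]
    refine Finset.sum_congr rfl fun n _ => ?_
    show ∑ y ∈ (univ : Finset (Fin (k + 2) × Fin T)) ×ˢ saws 3 n, (2 * s) ^ n = _
    rw [Finset.sum_const, Finset.card_product, Finset.card_univ, Fintype.card_prod, Fintype.card_fin, Fintype.card_fin,
      nsmul_eq_mul]
    push_cast
    ring
  -- Step 4: `cₙ ≤ C νⁿ` and the geometric tail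
  have h4 : ∀ n ∈ Finset.Ico (k + 2) (M + 1),
      ((k : ℝ) + 2) * T * ((saws 3 n).card : ℝ) * (2 * s) ^ n ≤ ((k : ℝ) + 2) * T * C * r ^ n := by
    intro n _
    have hc : ((saws 3 n).card : ℝ) ≤ C * ν ^ n := by
      rw [card_saws]
      exact hC n
    have hk : (0 : ℝ) ≤ ((k : ℝ) + 2) * T := by positivity
    calc ((k : ℝ) + 2) * T * ((saws 3 n).card : ℝ) * (2 * s) ^ n ≤ ((k : ℝ) + 2) * T * (C * ν ^ n) * (2 * s) ^ n :=
          mul_le_mul_of_nonneg_right (mul_le_mul_of_nonneg_left hc hk) (pow_nonneg (by positivity) _)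
      _ = ((k : ℝ) + 2) * T * C * r ^ n := by
          rw [hr, mul_pow, mul_pow, mul_pow]
          ring
  have hgeom := geom_tail_le hr0 hr1 (k + 2) (M + 1)
  calc ∑ S ∈ F.image supp, bernoulliWeight p S
      ≤ ∑ x ∈ Ps, (2 * s) ^ (Tm x).card := h1
    _ ≤ ∑ x ∈ I, (2 * s) ^ x.1 := h2
    _ = ∑ n ∈ Finset.Ico (k + 2) (M + 1), ((k : ℝ) + 2) * T * ((saws 3 n).card : ℝ) * (2 * s) ^ n := h3
    _ ≤ ∑ n ∈ Finset.Ico (k + 2) (M + 1), ((k : ℝ) + 2) * T * C * r ^ n := Finset.sum_le_sum h4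
    _ = ((k : ℝ) + 2) * T * C * ∑ n ∈ Finset.Ico (k + 2) (M + 1), r ^ n := by rw [Finset.mul_sum]
    _ ≤ ((k : ℝ) + 2) * T * C * (r ^ (k + 2) / (1 - r)) := mul_le_mul_of_nonneg_left hgeom (by positivity)
    _ = ((k : ℝ) + 2) * T * C * r ^ (k + 2) / (1 - r) := by ring

open Classical in
/-- **The planar space-time counting bound tends to zero below `p₀(ν)`**: under `cₙ(ℤ³) ≤ C νⁿ`, for every polynomially
bounded schedule of rounds `T(k)`, every family `D k` of minimum-weight space-time decoders of the `H_X`-sectors of the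
planar surface codes and every `0 ≤ p ≤ 1/2` with `4ν² p(1-p) < 1` (`q = p`), the probability of an odd-crossing residual
tends to `0` as `k → ∞` (`(k+2)·T(k)·r^{k+2} → 0`). [cite: DennisEtAl2002, §5.3 eqs. (threshold_iso), (fail_iso)] -/
theorem st_tendsto_sum_oddResidual {C ν : ℝ} (hν : 0 < ν) (hC : ToricCode.SAWCountBound3 C ν)
    {Tk : ℕ → ℕ} (hT : ToricCode.IsPolyBounded Tk)
    (D : ∀ k, STDecoder (PlanarCheck k) (PlanarQubit k) (Tk k))
    (hD : ∀ k, (D k).IsMinWeight (stSyn (planarHX k) (Tk k)) (stCycles (planarHX k) (Tk k)) hammingNorm)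
    {p : ℝ} (hp0 : 0 ≤ p) (hp : p ≤ 1 / 2) (h4 : 4 * ν ^ 2 * (p * (1 - p)) < 1) :
    Tendsto (fun k => ∑ E ∈ univ.filter (fun E : History (PlanarCheck k) (PlanarQubit k) (Tk k) =>
        ∑ b : Fin (k + 2), proj (D k (stSyn (planarHX k) (Tk k) E) + E) (Sum.inl (0, b)) = 1),
        phenomenologicalWeight (Tk k) p p (supp E)) atTop (𝓝 0) := by
  set s := Real.sqrt (p * (1 - p)) with hs
  set r := 2 * ν * s with hr
  have hs0 : 0 ≤ s := Real.sqrt_nonneg _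
  have hr0 : 0 ≤ r := by rw [hr]; positivity
  have hpp : 0 ≤ p * (1 - p) := mul_nonneg hp0 (by linarith)
  have hr1 : r < 1 := by
    have hsq : r ^ 2 = 4 * ν ^ 2 * (p * (1 - p)) := by
      rw [hr, mul_pow, mul_pow, hs, Real.sq_sqrt hpp]
      ring
    have h : r ^ 2 < 1 := by rw [hsq]; exact h4
    have := (sq_lt_one_iff_abs_lt_one r).1 h
    rwa [abs_of_nonneg hr0] at this
  have h1r : 0 < 1 - r := by linarith
  have hC0 : 0 ≤ C := nonneg_of_sawCountBound3 hC
  obtain ⟨A, m, hA⟩ := hT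
  have hA0 : 0 ≤ A := by
    have := hA 0
    have h0 : (0 : ℝ) ≤ (Tk 0 : ℝ) := Nat.cast_nonneg _
    simp only [Nat.cast_zero, zero_add, one_pow, mul_one] at this
    linarith
  have hbound : ∀ k : ℕ, (∑ E ∈ univ.filter (fun E : History (PlanarCheck k) (PlanarQubit k) (Tk k) =>
        ∑ b : Fin (k + 2), proj (D k (stSyn (planarHX k) (Tk k) E) + E) (Sum.inl (0, b)) = 1),
        phenomenologicalWeight (Tk k) p p (supp E)) ≤
      ((k : ℝ) + 2) * (A * ((k : ℝ) + 1) ^ m) * C * r ^ (k + 2) / (1 - r) := by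
    intro k
    refine (st_sum_oddResidual_le hν hC (hD k) hp0 hp hr1).trans ?_
    have hk : (0 : ℝ) ≤ (k : ℝ) + 2 := by positivity
    have h1 : ((k : ℝ) + 2) * (Tk k : ℝ) * C ≤ ((k : ℝ) + 2) * (A * ((k : ℝ) + 1) ^ m) * C :=
      mul_le_mul_of_nonneg_right (mul_le_mul_of_nonneg_left (hA k) hk) hC0
    exact div_le_div_of_nonneg_right (mul_le_mul_of_nonneg_right h1 (pow_nonneg hr0 _)) h1r.le
  have hnonneg : ∀ k : ℕ, 0 ≤ ∑ E ∈ univ.filter (fun E : History (PlanarCheck k) (PlanarQubit k) (Tk k) =>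
        ∑ b : Fin (k + 2), proj (D k (stSyn (planarHX k) (Tk k) E) + E) (Sum.inl (0, b)) = 1),
        phenomenologicalWeight (Tk k) p p (supp E) := by
    intro k
    refine Finset.sum_nonneg fun E _ => ?_
    rw [ToricCode.phenomenologicalWeight_self]
    exact bernoulliWeight_nonneg hp0 (by linarith) _
  -- the bound tends to zero: `(k+2)(k+1)^m r^{k+2} ≤ 2 (k+1)^{m+1} r^{k+2} → 0`
  have hlim : Tendsto (fun k : ℕ => ((k : ℝ) + 2) * (A * ((k : ℝ) + 1) ^ m) * C * r ^ (k + 2) / (1 - r))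
      atTop (𝓝 0) := by
    have h0 := tendsto_pow_const_mul_const_pow_of_abs_lt_one (m + 1) (show |r| < 1 by rwa [abs_of_nonneg hr0])
    have h1 : Tendsto (fun k : ℕ => ((k + 1 : ℕ) : ℝ) ^ (m + 1) * r ^ (k + 1)) atTop (𝓝 0) :=
      (Filter.tendsto_add_atTop_iff_nat 1).2 h0
    have h2 := h1.const_mul (2 * A * C * r / (1 - r))
    rw [mul_zero] at h2
    have hle : ∀ k : ℕ, ((k : ℝ) + 2) * (A * ((k : ℝ) + 1) ^ m) * C * r ^ (k + 2) / (1 - r) ≤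
        2 * A * C * r / (1 - r) * (((k + 1 : ℕ) : ℝ) ^ (m + 1) * r ^ (k + 1)) := by
      intro k
      have hk2 : (k : ℝ) + 2 ≤ 2 * ((k : ℝ) + 1) := by linarith [(Nat.cast_nonneg k : (0 : ℝ) ≤ k)]
      have hX : 0 ≤ A * ((k : ℝ) + 1) ^ m * C * r ^ (k + 2) / (1 - r) := by positivity
      calc ((k : ℝ) + 2) * (A * ((k : ℝ) + 1) ^ m) * C * r ^ (k + 2) / (1 - r)
          = ((k : ℝ) + 2) * (A * ((k : ℝ) + 1) ^ m * C * r ^ (k + 2) / (1 - r)) := by ring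
        _ ≤ 2 * ((k : ℝ) + 1) * (A * ((k : ℝ) + 1) ^ m * C * r ^ (k + 2) / (1 - r)) :=
            mul_le_mul_of_nonneg_right hk2 hX
        _ = 2 * A * C * r / (1 - r) * (((k + 1 : ℕ) : ℝ) ^ (m + 1) * r ^ (k + 1)) := by
            push_cast
            ring
    have hnn : ∀ k : ℕ, 0 ≤ ((k : ℝ) + 2) * (A * ((k : ℝ) + 1) ^ m) * C * r ^ (k + 2) / (1 - r) :=
      fun k => by positivity
    exact squeeze_zero hnn hle h2
  exact squeeze_zero hnonneg hbound hlim

end PlanarCode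

end Literature.InformationTheory.QuantumCodes
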